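import Summits.Ventures.PercRepro.RankLevelSetCircuitUnionRank

/-!
# PercRepro — THE CONFINEMENT LEMMA: the complement of a spanning set is confined by every set's nullity (p8 g12, S3)

For `A ⊆ E` spanning (`r(A) = r(M) = p`) in a finite matroid with `|E| = p + d`, and ANY `S ⊆ E`:
`|(E ∖ A) ∖ S| + |S| ≤ d + r(S)`, i.e. `|(E ∖ A) ∖ S| ≤ d − ν(S)` (`ν` = nullity). Proof:
`p = r(A) ≤ r(A ∩ S) + r(A ∖ S) ≤ r(S) + |A ∖ S|` and `|A ∖ S| + |(E ∖ A) ∖ S| + |S| = |E|`.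
Consequences for the sets `A ∈ U` of `RLS M p q` (`r(A) = p`, `r(E ∖ A) = q`), with `B = E ∖ A` (`|B| ≤ d`):
a cobasis (`|B| = d`) meets EVERY circuit (`inter_nonempty_of_spanning_of_isCircuit`); a `(d − 1)`-set `B` meets
the union of ANY two distinct circuits (`inter_union_nonempty_of_spanning_of_two_circuits`, on the nullity-`2`
lemma `eRk_union_add_two_le_of_isCircuit_ne`); a rank-`5` set `H` of `4 + d` points leaves `≤ 1` point of `B`
outside (g11's `H`-dichotomy is the case `S = H`). The cell's count of `U` never used that `E ∖ B` has nullity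
EXACTLY `d − |B|`; at `(22, 7)` this closes the coloop-free cell: two distinct triangles `C₁ ≠ C₂` force every
independent coindependent `6`-set to meet `C₁ ∪ C₂` — `≥ C(23, 6) = 100 947` of the `C(29, 6)` sets are lost,
against an excess of `≈ 52 000` (`proofs/P8-G12-LEVER22.md`). Axioms: standard.
-/

open scoped Matroid

namespace PercRepro

namespace ThmN

open Set

variable {α : Type}

/-- **The confinement lemma.** `A ⊆ E` spanning, `|E| = p + d`, `S ⊆ E` of rank `rS`:
`|(E ∖ A) ∖ S| + |S| ≤ d + rS`. -/
theorem ncard_diff_diff_add_ncard_le_of_spanning (M : Matroid α) [M.Finite] {A S : Set α}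
    (hA : A ⊆ M.E) (hS : S ⊆ M.E) {p d : ℕ} (hn : M.E.ncard = p + d)
    (hspan : M.eRk A = (p : ℕ∞)) {rS : ℕ} (hrS : M.eRk S = (rS : ℕ∞)) :
    ((M.E \ A) \ S).ncard + S.ncard ≤ d + rS := by
  have hEfin : M.E.Finite := M.ground_finite
  have hAfin : A.Finite := hEfin.subset hA
  have hSfin : S.Finite := hEfin.subset hS
  have h1 : M.eRk A ≤ M.eRk (A ∩ S) + M.eRk (A \ S) := by
    calc M.eRk A = M.eRk ((A ∩ S) ∪ (A \ S)) := by rw [Set.inter_union_sdiff]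
      _ ≤ M.eRk (A ∩ S) + M.eRk (A \ S) := M.eRk_union_le_eRk_add_eRk _ _
  have h2 : M.eRk (A ∩ S) ≤ M.eRk S := M.eRk_mono Set.inter_subset_right
  have h3 : M.eRk (A \ S) ≤ ((A \ S).ncard : ℕ∞) := by
    rw [hAfin.sdiff.cast_ncard_eq]
    exact M.eRk_le_encard _
  have hp : (p : ℕ∞) ≤ (rS : ℕ∞) + ((A \ S).ncard : ℕ∞) := by
    calc (p : ℕ∞) = M.eRk A := hspan.symm
      _ ≤ M.eRk (A ∩ S) + M.eRk (A \ S) := h1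
      _ ≤ M.eRk S + ((A \ S).ncard : ℕ∞) := add_le_add h2 h3
      _ = (rS : ℕ∞) + ((A \ S).ncard : ℕ∞) := by rw [hrS]
  have hpN : p ≤ rS + (A \ S).ncard := by exact_mod_cast hp
  have hc1 : (A ∩ S).ncard + (A \ S).ncard = A.ncard :=
    Set.ncard_inter_add_ncard_sdiff_eq_ncard A S hAfin
  have hc2 : ((M.E \ A) ∩ S).ncard + ((M.E \ A) \ S).ncard = (M.E \ A).ncard :=
    Set.ncard_inter_add_ncard_sdiff_eq_ncard (M.E \ A) S hEfin.sdiff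
  have hc3 : (M.E \ A).ncard + A.ncard = M.E.ncard := Set.ncard_sdiff_add_ncard_of_subset hA hEfin
  have hc4 : (S ∩ A).ncard + (S \ A).ncard = S.ncard :=
    Set.ncard_inter_add_ncard_sdiff_eq_ncard S A hSfin
  have he1 : S ∩ A = A ∩ S := Set.inter_comm _ _
  have he2 : S \ A = (M.E \ A) ∩ S := by
    ext x
    constructor
    · rintro ⟨hxS, hxA⟩
      exact ⟨⟨hS hxS, hxA⟩, hxS⟩
    · rintro ⟨⟨_, hxA⟩, hxS⟩
      exact ⟨hxS, hxA⟩
  rw [he1, he2] at hc4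
  omega

/-- **Two distinct circuits have a union of nullity `≥ 2`**: `r(C₁ ∪ C₂) + 2 ≤ |C₁ ∪ C₂|`
(`C₁ ∩ C₂ ⊊ C₁` is independent; submodularity; `r(C_i) + 1 = |C_i|`). -/
theorem eRk_union_add_two_le_of_isCircuit_ne (M : Matroid α) [M.Finite] {C₁ C₂ : Set α}
    (h1 : M.IsCircuit C₁) (h2 : M.IsCircuit C₂) (hne : C₁ ≠ C₂) {r : ℕ}
    (hr : M.eRk (C₁ ∪ C₂) = (r : ℕ∞)) : r + 2 ≤ (C₁ ∪ C₂).ncard := by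
  have hEfin : M.E.Finite := M.ground_finite
  have hf1 : C₁.Finite := hEfin.subset h1.subset_ground
  have hf2 : C₂.Finite := hEfin.subset h2.subset_ground
  have hss : C₁ ∩ C₂ ⊂ C₁ := by
    refine ⟨Set.inter_subset_left, fun h => hne ?_⟩
    exact h1.eq_of_subset_isCircuit h2 (fun x hx => (h hx).2)
  have hI : M.Indep (C₁ ∩ C₂) := h1.ssubset_indep hss
  have hIr : M.eRk (C₁ ∩ C₂) = ((C₁ ∩ C₂).ncard : ℕ∞) := by
    rw [hI.eRk_eq_encard, (hf1.subset Set.inter_subset_left).cast_ncard_eq]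
  obtain ⟨r1, hr1⟩ := exists_eRk_eq_nat M C₁
  obtain ⟨r2, hr2⟩ := exists_eRk_eq_nat M C₂
  have hC1 : r1 + 1 = C₁.ncard := by
    have h := h1.eRk_add_one_eq
    rw [hr1, ← hf1.cast_ncard_eq] at h
    exact_mod_cast h
  have hC2 : r2 + 1 = C₂.ncard := by
    have h := h2.eRk_add_one_eq
    rw [hr2, ← hf2.cast_ncard_eq] at h
    exact_mod_cast h
  have hsub := M.eRk_inter_add_eRk_union_le C₁ C₂
  rw [hIr, hr, hr1, hr2] at hsub
  have hsubN : (C₁ ∩ C₂).ncard + r ≤ r1 + r2 := by exact_mod_cast hsub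
  have hu : (C₁ ∪ C₂).ncard + (C₁ ∩ C₂).ncard = C₁.ncard + C₂.ncard :=
    Set.ncard_union_add_ncard_inter C₁ C₂ hf1 hf2
  omega

/-- **A cobasis meets every circuit**: `A` spanning with `|E ∖ A| ≥ d` (so `E ∖ A` is a cobasis) meets
every circuit `C`. -/
theorem inter_nonempty_of_spanning_of_isCircuit (M : Matroid α) [M.Finite] {A C : Set α}
    (hA : A ⊆ M.E) (hC : M.IsCircuit C) {p d : ℕ} (hn : M.E.ncard = p + d)
    (hspan : M.eRk A = (p : ℕ∞)) (hB : d ≤ (M.E \ A).ncard) : ((M.E \ A) ∩ C).Nonempty := by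
  obtain ⟨rC, hrC⟩ := exists_eRk_eq_nat M C
  have hCf : C.Finite := M.ground_finite.subset hC.subset_ground
  have hCr : rC + 1 = C.ncard := by
    have h := hC.eRk_add_one_eq
    rw [hrC, ← hCf.cast_ncard_eq] at h
    exact_mod_cast h
  have key := ncard_diff_diff_add_ncard_le_of_spanning M hA hC.subset_ground hn hspan hrC
  have hc : ((M.E \ A) ∩ C).ncard + ((M.E \ A) \ C).ncard = (M.E \ A).ncard :=
    Set.ncard_inter_add_ncard_sdiff_eq_ncard (M.E \ A) C M.ground_finite.sdiff
  exact Set.nonempty_of_ncard_ne_zero (by omega)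

/-- **The `(d − 1)`-sets of `U` meet the union of any two distinct circuits**: `A` spanning with
`|E ∖ A| ≥ d − 1` meets `C₁ ∪ C₂` for every two distinct circuits. At `(22, 7)`: every independent
coindependent `6`-set meets `C₁ ∪ C₂`. -/
theorem inter_union_nonempty_of_spanning_of_two_circuits (M : Matroid α) [M.Finite] {A C₁ C₂ : Set α}
    (hA : A ⊆ M.E) (h1 : M.IsCircuit C₁) (h2 : M.IsCircuit C₂) (hne : C₁ ≠ C₂) {p d : ℕ}
    (hn : M.E.ncard = p + d) (hspan : M.eRk A = (p : ℕ∞)) (hB : d ≤ (M.E \ A).ncard + 1) :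
    ((M.E \ A) ∩ (C₁ ∪ C₂)).Nonempty := by
  obtain ⟨r, hr⟩ := exists_eRk_eq_nat M (C₁ ∪ C₂)
  have hnu := eRk_union_add_two_le_of_isCircuit_ne M h1 h2 hne hr
  have hSE : C₁ ∪ C₂ ⊆ M.E := Set.union_subset h1.subset_ground h2.subset_ground
  have key := ncard_diff_diff_add_ncard_le_of_spanning M hA hSE hn hspan hr
  have hc : ((M.E \ A) ∩ (C₁ ∪ C₂)).ncard + ((M.E \ A) \ (C₁ ∪ C₂)).ncard = (M.E \ A).ncard :=
    Set.ncard_inter_add_ncard_sdiff_eq_ncard (M.E \ A) (C₁ ∪ C₂) M.ground_finite.sdiff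
  exact Set.nonempty_of_ncard_ne_zero (by omega)

/-- **The `H`-confinement** (g11's dichotomy as a corollary): a set `H` with `|H| = rH + d − 1`
(nullity `d − 1`) leaves at most one point of `E ∖ A` outside, for every spanning `A`. -/
theorem ncard_diff_diff_le_one_of_spanning (M : Matroid α) [M.Finite] {A H : Set α}
    (hA : A ⊆ M.E) (hH : H ⊆ M.E) {p d : ℕ} (hn : M.E.ncard = p + d)
    (hspan : M.eRk A = (p : ℕ∞)) {rH : ℕ} (hrH : M.eRk H = (rH : ℕ∞))
    (hcard : H.ncard + 1 = rH + d) : ((M.E \ A) \ H).ncard ≤ 1 := by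
  have key := ncard_diff_diff_add_ncard_le_of_spanning M hA hH hn hspan hrH
  omega

/-- **An irredundant circuit raises the nullity by one**: for a circuit `C ⊄ S`,
`|S| + r(S ∪ C) + 1 ≤ |S ∪ C| + r(S)` (i.e. `ν(S ∪ C) ≥ ν(S) + 1`): `S ∩ C ⊊ C` is independent,
submodularity, `r(C) + 1 = |C|`. -/
theorem ncard_add_eRk_union_circuit_succ_le (M : Matroid α) [M.Finite] {S C : Set α}
    (hS : S ⊆ M.E) (hC : M.IsCircuit C) (hCS : ¬ C ⊆ S) {rS rU : ℕ} (hrS : M.eRk S = (rS : ℕ∞))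
    (hrU : M.eRk (S ∪ C) = (rU : ℕ∞)) : S.ncard + rU + 1 ≤ (S ∪ C).ncard + rS := by
  have hSfin : S.Finite := M.ground_finite.subset hS
  have hCfin : C.Finite := M.ground_finite.subset hC.subset_ground
  have hssub : S ∩ C ⊂ C := ⟨Set.inter_subset_right, fun h => hCS (fun x hx => (h hx).1)⟩
  have hI : M.Indep (S ∩ C) := hC.ssubset_indep hssub
  have hIr : M.eRk (S ∩ C) = ((S ∩ C).ncard : ℕ∞) := by
    rw [hI.eRk_eq_encard, (hSfin.subset Set.inter_subset_left).cast_ncard_eq]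
  obtain ⟨rc, hrc⟩ := exists_eRk_eq_nat M C
  have hCr : rc + 1 = C.ncard := by
    have h := hC.eRk_add_one_eq
    rw [hrc, ← hCfin.cast_ncard_eq] at h
    exact_mod_cast h
  have hsub := M.eRk_inter_add_eRk_union_le S C
  rw [hIr, hrU, hrS, hrc] at hsub
  have hsubN : (S ∩ C).ncard + rU ≤ rS + rc := by exact_mod_cast hsub
  have hu : (S ∪ C).ncard + (S ∩ C).ncard = S.ncard + C.ncard :=
    Set.ncard_union_add_ncard_inter S C hSfin hCfin
  omega

/-- **Three triangles pairwise sharing at most one point have a union of nullity `≥ 3`**: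
`r(C₁ ∪ C₂ ∪ C₃) + 3 ≤ |C₁ ∪ C₂ ∪ C₃|` (two chain steps of `ncard_add_eRk_union_circuit_succ_le`;
`C₂ ⊄ C₁` and `C₃ ⊄ C₁ ∪ C₂` by the intersection sizes). -/
theorem eRk_union_three_triangles_add_three_le (M : Matroid α) [M.Finite] {C₁ C₂ C₃ : Set α}
    (h1 : M.IsCircuit C₁) (h2 : M.IsCircuit C₂) (h3 : M.IsCircuit C₃)
    (n1 : C₁.ncard = 3) (n2 : C₂.ncard = 3) (n3 : C₃.ncard = 3)
    (h12 : (C₁ ∩ C₂).ncard ≤ 1) (h13 : (C₁ ∩ C₃).ncard ≤ 1) (h23 : (C₂ ∩ C₃).ncard ≤ 1)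
    {r : ℕ} (hr : M.eRk (C₁ ∪ C₂ ∪ C₃) = (r : ℕ∞)) : r + 3 ≤ (C₁ ∪ C₂ ∪ C₃).ncard := by
  have hEfin : M.E.Finite := M.ground_finite
  have hf1 : C₁.Finite := hEfin.subset h1.subset_ground
  have hf2 : C₂.Finite := hEfin.subset h2.subset_ground
  have hf3 : C₃.Finite := hEfin.subset h3.subset_ground
  have h12E : C₁ ∪ C₂ ⊆ M.E := Set.union_subset h1.subset_ground h2.subset_ground
  -- C₂ ⊄ C₁
  have hC21 : ¬ C₂ ⊆ C₁ := by
    intro h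
    have : C₁ ∩ C₂ = C₂ := Set.inter_eq_right.mpr h
    rw [this] at h12
    omega
  -- C₃ ⊄ C₁ ∪ C₂
  have hC312 : ¬ C₃ ⊆ C₁ ∪ C₂ := by
    intro h
    have he : C₃ = (C₁ ∩ C₃) ∪ (C₂ ∩ C₃) := by
      ext x
      constructor
      · intro hx
        rcases h hx with hx1 | hx2
        · exact Or.inl ⟨hx1, hx⟩
        · exact Or.inr ⟨hx2, hx⟩
      · rintro (⟨_, hx⟩ | ⟨_, hx⟩) <;> exact hx
    have hle : C₃.ncard ≤ (C₁ ∩ C₃).ncard + (C₂ ∩ C₃).ncard := by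
      calc C₃.ncard = ((C₁ ∩ C₃) ∪ (C₂ ∩ C₃)).ncard := by rw [← he]
        _ ≤ (C₁ ∩ C₃).ncard + (C₂ ∩ C₃).ncard := Set.ncard_union_le _ _
    omega
  obtain ⟨r1, hr1⟩ := exists_eRk_eq_nat M C₁
  obtain ⟨r12, hr12⟩ := exists_eRk_eq_nat M (C₁ ∪ C₂)
  have hC1r : r1 + 1 = C₁.ncard := by
    have h := h1.eRk_add_one_eq
    rw [hr1, ← hf1.cast_ncard_eq] at h
    exact_mod_cast h
  have step1 := ncard_add_eRk_union_circuit_succ_le M h1.subset_ground h2 hC21 hr1 hr12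
  have step2 := ncard_add_eRk_union_circuit_succ_le M h12E h3 hC312 hr12 hr
  omega

/-- **The `6`-sets of `U` at corank `d ≤ |B| + 2` meet the union of three triangles pairwise sharing
at most one point** (at `(22, 8)`: every independent coindependent `6`-set meets `C₁ ∪ C₂ ∪ C₃`). -/
theorem inter_union_nonempty_of_spanning_of_three_triangles (M : Matroid α) [M.Finite]
    {A C₁ C₂ C₃ : Set α} (hA : A ⊆ M.E)
    (h1 : M.IsCircuit C₁) (h2 : M.IsCircuit C₂) (h3 : M.IsCircuit C₃)
    (n1 : C₁.ncard = 3) (n2 : C₂.ncard = 3) (n3 : C₃.ncard = 3)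
    (h12 : (C₁ ∩ C₂).ncard ≤ 1) (h13 : (C₁ ∩ C₃).ncard ≤ 1) (h23 : (C₂ ∩ C₃).ncard ≤ 1) {p d : ℕ}
    (hn : M.E.ncard = p + d) (hspan : M.eRk A = (p : ℕ∞)) (hB : d ≤ (M.E \ A).ncard + 2) :
    ((M.E \ A) ∩ (C₁ ∪ C₂ ∪ C₃)).Nonempty := by
  obtain ⟨r, hr⟩ := exists_eRk_eq_nat M (C₁ ∪ C₂ ∪ C₃)
  have hnu := eRk_union_three_triangles_add_three_le M h1 h2 h3 n1 n2 n3 h12 h13 h23 hr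
  have hSE : C₁ ∪ C₂ ∪ C₃ ⊆ M.E :=
    Set.union_subset (Set.union_subset h1.subset_ground h2.subset_ground) h3.subset_ground
  have key := ncard_diff_diff_add_ncard_le_of_spanning M hA hSE hn hspan hr
  have hc : ((M.E \ A) ∩ (C₁ ∪ C₂ ∪ C₃)).ncard + ((M.E \ A) \ (C₁ ∪ C₂ ∪ C₃)).ncard
      = (M.E \ A).ncard :=
    Set.ncard_inter_add_ncard_sdiff_eq_ncard (M.E \ A) (C₁ ∪ C₂ ∪ C₃) M.ground_finite.sdiff
  exact Set.nonempty_of_ncard_ne_zero (by omega)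

end ThmN

end PercRepro
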